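import Literature.NumberTheory.GaloisCohomology.TateGlobalEulerCharacteristic
import Literature.NumberTheory.GaloisCohomology.RestrictedRamificationFiniteCohomologyOfPoitouTate
import HarnessLib

/-!
# Harari Cor. 17.17 (= NSW (8.3.20) (i), Milne I Cor. 4.15) FROM Tate's global Euler–Poincaré
# characteristic (Milne I Thm. 5.1) AS TYPED and Poitou–Tate 17.13 (a): `Hʳ(G_S, M)` is finite

Topic `NumberTheory/GaloisCohomology`; namespace `Literature.NumberTheory.GaloisCohomology`.
THEOREMS ONLY (no definition, no named fact, no `sorry`, no instance).

The tree vendors, as separate named facts (`def … : Prop`, nothing asserted), Tate's global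
Euler–Poincaré characteristic formula `tateGlobalEulerPoincareCharacteristic K`
(`TateGlobalEulerCharacteristic.lean`, Milne I Thm. 5.1), Harari's Thm. 17.13 (a)
`poitouTate_restricted_three_le K` (`Hʳ(G_S, M) ≃ ∏_{w real} Hʳ(K_w, M)`, `r ≥ 3`) and the
finiteness corollary `finite_restrictedCohomology K` (Harari Cor. 17.17 = NSW (8.3.20) (i) = Milne
I Cor. 4.15), all three over the same hypothesis block: `S` a FINITE set of finite places, `M` a
finite discrete `Γ_K`-module unramified outside `S` with `#M` invertible in `𝒪_{K,S}`.

**Observation.** The Euler-characteristic fact is typed in `Nat.card` currency WITHOUT folding in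
the finiteness of the `Hʳ(G_S, M)` (its docstring: "Finiteness of the `Hʳ(G_S, M)` … is the
SEPARATE tree fact `finite_restrictedCohomology K` … and is not folded in"):

  `#H⁰(G_S, M) · #H²(G_S, M) · ∏_{w ∣ ∞} #M^{mult w} = #H¹(G_S, M) · ∏_{w ∣ ∞} #H⁰(K_w, M)`.

Its right-hand side is a NON-ZERO natural number unconditionally: `H¹(G_S, M)` is finite by
Hermite's theorem (`G_{K,S}` is of type (F) — the tree's
`finite_setOf_isOpen_index_le_galoisGroupUnramifiedOutside` — and Serre III §4.1 Prop. 8, the tree's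
`ContinuousRep.finite_continuousCohomology_one`), and `H⁰(K_w, M)` is finite at every infinite
place because `Γ_{K_w}` is finite (`finite_absoluteGaloisGroup_completion_infinitePlace`,
`finite_continuousCohomology_of_finite`).  Hence, granted the fact, `#H²(G_S, M) ≠ 0`, i.e.
(`Nat.card` of an infinite type being `0`) **`H²(G_S, M)` is finite**.  Degrees `0, 1` are tree
theorems and the degrees `r ≥ 3` follow from Thm. 17.13 (a) exactly as in the sibling
`RestrictedRamificationFiniteCohomologyOfPoitouTate.lean` (which needs Thm. 17.13 (b) for `r = 2`).

Main result: **`finite_restrictedCohomology_of_tate_of_poitouTate_three_le :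
tateGlobalEulerPoincareCharacteristic K → poitouTate_restricted_three_le K →
finite_restrictedCohomology K`**.  Consequence for the tree: wherever the three facts Tate I.5.1,
Poitou–Tate 17.13 (a) and NSW (8.3.20) are consumed together (Greenberg 2006 Props. 3.2 / 4.1:
`Greenberg2006.prop41_of_tateGlobalEulerPoincareCharacteristic`,
`Greenberg2006.prop32_cohomology_isCofinitelyGenerated_of_finite_restrictedCohomology`), the third
is REDUNDANT as typed.  This is a remark about the tree's typings, not a new proof of Cor. 17.17:
in print Thm. 5.1 is stated for groups already known to be finite (Milne I §5, p. 66: "We know from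
(4.15) that the groups `Hʳ(G_S, M)` are finite for all `r`").

## References
* J. S. Milne, *Arithmetic Duality Theorems*, 2nd ed. (2006), I Thm. 5.1 (p. 67), I Cor. 4.15
  (p. 61). [MilneADT2006]
* D. Harari, *Galois Cohomology and Class Field Theory*, Universitext (2020), Thm. 17.13 (a),
  Cor. 17.17 (pp. 294–296). [Harari2020]
* J. Neukirch, A. Schmidt, K. Wingberg, *Cohomology of Number Fields*, 2nd ed. (2008), (8.3.20) (i),
  (8.7.4). [NeukirchSchmidtWingberg2008]
* J.-P. Serre, *Cohomologie galoisienne* (1994), III §4.1 Prop. 8 (type (F) ⟹ `H¹` finite).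
  [SerreGaloisCohomology1997]
-/

noncomputable section

open CategoryTheory Function NumberField Field IsDedekindDomain
open scoped NumberField

namespace Literature.NumberTheory.GaloisCohomology

open Literature.NumberTheory.GaloisRepresentations
open Literature.NumberTheory.GaloisRepresentations.DiscreteGaloisModule (restrictedCohomology
  restrictedLocalization toLocal)
open _root_.TopRep _root_.ContRepresentation _root_.ContinuousCohomology

variable {K : Type} [Field K] [NumberField K]

/-! ### §1. The unconditional finiteness inputs, in `restrictedCohomology` currency -/

section Inputs

variable {M : Type} [AddCommGroup M] [TopologicalSpace M] [DiscreteTopology M] [Finite M]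

omit [NumberField K] in
/-- `H⁰(G_S, M^{N_S})` is finite for a finite discrete `Γ_K`-module `M` (any `S`): it is the module
of `G_S`-invariants of the finite `M^{N_S}`. [cite: Harari2020, Cor. 17.17 (proof, p. 296)] -/
theorem finite_restrictedCohomology_zero [CharZero K] (S : Set (HeightOneSpectrum (𝓞 K)))
    (ρ : DiscreteGaloisModule K M) : Finite (restrictedCohomology ρ S 0) :=
  finite_continuousCohomology_zero (X := (ρ.quotientInvariants (ramificationSubgroup K S)).toTopRep)

/-- **`H¹(G_S, M^{N_S})` is finite** for `S` a FINITE set of finite places and `M` a finite discrete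
`Γ_K`-module — unconditionally, by Hermite's theorem (`G_{K,S}` has finitely many open subgroups
of each bounded index) and Serre III §4.1 Prop. 8.
[cite: SerreGaloisCohomology1997, Ch. III §4.1, Prop. 8 (a ⇒ b)] [cite: Harari2020, Cor. 17.17] -/
theorem finite_restrictedCohomology_one {S : Set (HeightOneSpectrum (𝓞 K))} (hS : S.Finite)
    (ρ : DiscreteGaloisModule K M) : Finite (restrictedCohomology ρ S 1) :=
  (ρ.quotientInvariants (ramificationSubgroup K S)).finite_continuousCohomology_one
    (fun n => finite_setOf_isOpen_index_le_galoisGroupUnramifiedOutside K hS n)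

/-- `Hʳ(K_w, M)` is finite in EVERY degree `r` at an infinite place `w` of `K`, for a finite
discrete `Γ_K`-module `M`: the absolute Galois group of `K_w ≅ ℝ` or `ℂ` is finite (of order
`≤ 2`), and a finite group has finite cohomology with finite coefficients.
[cite: SerreGaloisCohomology1997, I §2.4] [cite: Harari2020, Cor. 8.15 and Remark 8.14] -/
theorem finite_galoisCohomology_toLocal_infinitePlace (ρ : DiscreteGaloisModule K M)
    (w : InfinitePlace K) (r : ℕ) : Finite (galoisCohomology (ρ.toLocal (Sum.inl w)) r) := by
  haveI : Finite (absoluteGaloisGroup (Place.Completion (Sum.inl w : Place K))) :=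
    finite_absoluteGaloisGroup_completion_infinitePlace w
  exact finite_continuousCohomology_of_finite (ρ.toLocal (Sum.inl w)).toTopRep r

end Inputs

/-! ### §2. Degree `2` from Tate's Euler characteristic as typed -/

section DegreeTwo

variable {M : Type} [AddCommGroup M] [TopologicalSpace M] [DiscreteTopology M] [Finite M]

/-- **The right-hand side of Tate's formula is non-zero**: `#H¹(G_S, M) · ∏_{w ∣ ∞} #H⁰(K_w, M) ≠ 0`
for `S` finite and `M` finite (both kinds of factor are cardinalities of finite non-empty groups).
[cite: MilneADT2006, Ch. I §5, Thm. 5.1 (p. 67)] -/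
theorem natCard_restrictedCohomology_one_mul_prod_ne_zero {S : Set (HeightOneSpectrum (𝓞 K))}
    (hS : S.Finite) (ρ : DiscreteGaloisModule K M) :
    Nat.card (restrictedCohomology ρ S 1) *
        ∏ w : InfinitePlace K, Nat.card (galoisCohomology (ρ.toLocal (Sum.inl w)) 0) ≠ 0 := by
  haveI := finite_restrictedCohomology_one hS ρ
  refine mul_ne_zero Nat.card_pos.ne' (Finset.prod_ne_zero_iff.2 fun w _ => ?_)
  haveI := finite_galoisCohomology_toLocal_infinitePlace ρ w 0
  exact Nat.card_pos.ne'

/-- **`H²(G_S, M)` is finite, GRANTED Tate's global Euler–Poincaré characteristic formula as typed**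
(`tateGlobalEulerPoincareCharacteristic K`, a `Nat.card` identity with no finiteness folded in):
for `S` a finite set of finite places and `M` a finite discrete `Γ_K`-module unramified outside `S`
with `#M` invertible in `𝒪_{K,S}`, the formula reads
`#H⁰ · #H² · ∏ #M^{mult w} = #H¹ · ∏ #H⁰(K_w, M)`, whose right-hand side is `≠ 0`
(`natCard_restrictedCohomology_one_mul_prod_ne_zero`), so `#H²(G_S, M) ≠ 0` and the `Nat.card` of
an infinite type is `0`. [cite: MilneADT2006, Ch. I §5, Thm. 5.1 (p. 67) and Cor. 4.15 (p. 61)] -/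
theorem finite_restrictedCohomology_two_of_tateGlobalEulerPoincareCharacteristic
    (hT : tateGlobalEulerPoincareCharacteristic K) {S : Set (HeightOneSpectrum (𝓞 K))}
    (hS : S.Finite) (ρ : DiscreteGaloisModule K M) (hur : GaloisRep.IsUnramifiedOutside S ρ)
    (hcard : ∀ v : HeightOneSpectrum (𝓞 K), ((Nat.card M : ℕ) : 𝓞 K) ∈ v.asIdeal → v ∈ S) :
    Finite (restrictedCohomology ρ S 2) := by
  have hrhs := natCard_restrictedCohomology_one_mul_prod_ne_zero hS ρ
  rw [← hT S hS M ρ hur hcard] at hrhs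
  exact Nat.finite_of_card_ne_zero (right_ne_zero_of_mul (left_ne_zero_of_mul hrhs))

/-- Under Tate's formula as typed, `#H²(G_S, M)` is a POSITIVE natural number (so the identity is
an identity of positive integers, as in print). [cite: MilneADT2006, Ch. I §5, Thm. 5.1 (p. 67)] -/
theorem natCard_restrictedCohomology_two_pos_of_tateGlobalEulerPoincareCharacteristic
    (hT : tateGlobalEulerPoincareCharacteristic K) {S : Set (HeightOneSpectrum (𝓞 K))}
    (hS : S.Finite) (ρ : DiscreteGaloisModule K M) (hur : GaloisRep.IsUnramifiedOutside S ρ)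
    (hcard : ∀ v : HeightOneSpectrum (𝓞 K), ((Nat.card M : ℕ) : 𝓞 K) ∈ v.asIdeal → v ∈ S) :
    0 < Nat.card (restrictedCohomology ρ S 2) := by
  haveI := finite_restrictedCohomology_two_of_tateGlobalEulerPoincareCharacteristic hT hS ρ hur hcard
  exact Nat.card_pos

end DegreeTwo

/-! ### §3. Cor. 17.17 from Thm. 5.1 and Thm. 17.13 (a) -/

/-- **Harari Cor. 17.17 (= NSW (8.3.20) (i), Milne I Cor. 4.15) from Tate's global Euler–Poincaré
characteristic formula (Milne I Thm. 5.1) AS TYPED and Poitou–Tate 17.13 (a)**: for a number field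
`K`, GRANTED `tateGlobalEulerPoincareCharacteristic K` and `poitouTate_restricted_three_le K`, the
groups `Hʳ(G_S, M)` are finite for every finite set `S` of finite places, every finite discrete
`Γ_K`-module `M` unramified outside `S` with `#M` invertible in `𝒪_{K,S}` and every `r ≥ 0` —
i.e. the named fact `finite_restrictedCohomology K` holds.  Degrees `0, 1`: unconditional
(invariants; Hermite + Serre III Prop. 8); degree `2`: the formula's right-hand side is non-zero;
degrees `r ≥ 3`: Thm. 17.13 (a) injects `Hʳ(G_S, M)` into the finite `∏_{w real} Hʳ(K_w, M)`.
So, among the three textbook facts {Milne I 5.1, Harari 17.13 (a), Harari 17.17} as typed in the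
tree, the third follows from the first two.
[cite: MilneADT2006, Ch. I §5, Thm. 5.1 (p. 67); I Cor. 4.15 (p. 61)]
[cite: Harari2020, Thm. 17.13 (a), Cor. 17.17 (pp. 294–296)] [cite: NeukirchSchmidtWingberg2008, (8.3.20)] -/
theorem finite_restrictedCohomology_of_tate_of_poitouTate_three_le
    (hT : tateGlobalEulerPoincareCharacteristic K) (ha : poitouTate_restricted_three_le K) :
    finite_restrictedCohomology K := by
  intro S hS M _ _ _ _ ρ hur hcard r
  match r with
  | 0 => exact finite_restrictedCohomology_zero S ρ
  | 1 => exact finite_restrictedCohomology_one hS ρ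
  | 2 => exact finite_restrictedCohomology_two_of_tateGlobalEulerPoincareCharacteristic hT hS ρ hur hcard
  | r + 3 =>
    -- Thm. 17.13 (a): `Hʳ(G_S, M) ↪ ∏_{w real} Hʳ(K_w, M)`, a finite group
    have hr : 3 ≤ r + 3 := Nat.le_add_left 3 r
    haveI : ∀ w : {w : InfinitePlace K // w.IsReal},
        Finite (galoisCohomology (ρ.toLocal (Sum.inl w.1)) (r + 3)) :=
      fun w => finite_galoisCohomology_toLocal_infinitePlace ρ w.1 (r + 3)
    exact Finite.of_injective _ (ha S M ρ hur hcard hr).1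

/-- The universally quantified form (the shape in which the facts are consumed as hypotheses, e.g.
by `Greenberg2006.prop41_of_tateGlobalEulerPoincareCharacteristic`): Tate I.5.1 and Poitou–Tate
17.13 (a) for every number field give Cor. 17.17 for every number field.
[cite: MilneADT2006, Ch. I §5, Thm. 5.1; I Cor. 4.15] [cite: Harari2020, Cor. 17.17] -/
theorem forall_finite_restrictedCohomology_of_tate_of_poitouTate_three_le
    (hT : ∀ (K : Type) [Field K] [NumberField K], tateGlobalEulerPoincareCharacteristic K)
    (ha : ∀ (K : Type) [Field K] [NumberField K], poitouTate_restricted_three_le K) :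
    ∀ (K : Type) [Field K] [NumberField K], finite_restrictedCohomology K :=
  fun K _ _ => finite_restrictedCohomology_of_tate_of_poitouTate_three_le (hT K) (ha K)

end Literature.NumberTheory.GaloisCohomology

end
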